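import Literature.Probability.FitznerVanDerHofstad2017.SrwIntegralLargeD
import Mathlib.Analysis.SpecialFunctions.Integrals.Basic
import HarnessLib

/-!
# Gaussian domination of the SRW return probabilities: `p_{2n}(0;d) ≤ (2n-1)‼ / (2d)^n`

CITATION HEADER. This module is part of a certified REPRODUCTION of:
  R. Fitzner, R. van der Hofstad, *Generalized approach to the non-backtracking lace expansion*,
  PTRF **169** (2017) 1041–1119 [NoBLE17], §5 (the SRW inputs `I_{n,l}(x)`, (5.1) p. 1090), as
  consumed by *Mean-field behavior for nearest-neighbor percolation in `d > 10`*, EJP **22** (2017)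
  no. 43 [FvdH17], Thm 1.1; it supplies the one analytic lemma ("E1") needed to turn the finite
  Taylor form `srwI_taylor` / `abs_srwI_sub_taylor_le` of `SrwIntegralLargeD.lean` into an
  enclosure of the SRW inputs whose remainder SCALES like `d^{-M/2}` (uniformly in `d`), namely the
  classical Gaussian-domination bound on the even return probabilities of simple random walk:

* **`srwLaw_two_mul_zero_le`** — `p_{2n}(0; d) ≤ (2n-1)‼ / (2d)^n` for all `d ≥ 1`, `n ≥ 0`.

Proof (kernel-checked here, folklore): `p_{2n}(0;d) = ∫ D̂(k)^{2n} dk/(2π)^d` with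
`d · D̂(k) = S_d(k) = Σ_j cos k_j` (`srwI_zero_eq_srwLaw`, `srwI_zero_eq_integral_phi`); the
coordinates are independent under `dk/(2π)^d` (`P d` is a product measure), so deleting one
coordinate (`measurePreserving_piFinSuccAbove`) and expanding `(cos k_0 + S_d)^m` binomially gives
the recursion `M_{d+1}(m) = Σ_a C(m,a) J(a) M_d(m-a)` for the un-normalised moments
`M_d(m) = ∫ S_d^m`, `J(a) = ∫_{-π}^{π} cos^a` (`sumMom_succ`); `J(2q+1) = 0` and
`J(2q) = 2π (2q-1)‼/(2q)‼ ≤ 2π (2q-1)‼ 2^{-q}` (Wallis, from Mathlib's `integral_cos_pow`), and the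
Gaussian moment identity `C(2n,2q) (2n-2q-1)‼ (2q-1)‼ = (2n-1)‼ C(n,q)` with the binomial theorem
close the induction `M_d(2n) ≤ (2π)^d (2n-1)‼ (d/2)^n` (`sumMom_even_le`), i.e. the even moments
of `S_d` are dominated by those of a centred Gaussian of variance `d/2`.

No hypothesis of any theorem here is a programme-internal claim: all statements are kernel-proved
from the tree's definitions (`srwLaw`, `srwI`, `Dhat`, `P`, `μI`).

## References
* [NoBLE17] R. Fitzner, R. van der Hofstad, PTRF 169 (2017) 1041–1119: (5.1) p. 1090 (bib key
  `FitznerVanDerHofstad2016NoBLE`).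
* [FvdH17] R. Fitzner, R. van der Hofstad, EJP 22 (2017) no. 43, Thm 1.1.
-/

noncomputable section

open MeasureTheory Real Finset Filter Topology
open scoped BigOperators Nat

namespace Literature.Probability.FitznerVanDerHofstad2017

open Literature.Barriers.CriticalPhenomena
open Literature.Barriers.CriticalPhenomena.Slade2006Prop53 (P μI)
open Literature.Barriers.CriticalPhenomena.LongRangePhi4 (srwLaw srwLaw_nonneg)
open DimMono

variable {d : ℕ}

namespace GaussDom

/-! ### Part 1. One-dimensional cosine moments `J(a) = ∫_{-π}^{π} cos^a` -/

/-- `J(a) = ∫_{[-π,π]} cos(x)^a dx`. [folklore] -/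
def cosMom (a : ℕ) : ℝ := ∫ x, Real.cos x ^ a ∂μI

/-- `J(a)` as an interval integral. [folklore] -/
theorem cosMom_eq_intervalIntegral (a : ℕ) :
    cosMom a = ∫ x in (-π)..π, Real.cos x ^ a := by
  rw [cosMom, show μI = volume.restrict (Set.Icc (-π) π) from rfl, integral_Icc_eq_integral_Ioc,
    ← intervalIntegral.integral_of_le (by linarith [pi_pos])]

/-- `J(0) = 2π`. [folklore] -/
theorem cosMom_zero : cosMom 0 = 2 * π := by
  simp only [cosMom, pow_zero]
  exact Slade2006Prop53.integral_one_μI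

/-- `J(1) = 0`. [folklore] -/
theorem cosMom_one : cosMom 1 = 0 := by
  simp only [cosMom, pow_one]
  exact Slade2006Prop53.integral_cos_μI

/-- Wallis' reduction `J(a+2) = (a+1)/(a+2) · J(a)` (the boundary terms vanish at `±π`).
[folklore] -/
theorem cosMom_add_two (a : ℕ) : cosMom (a + 2) = (a + 1) / (a + 2) * cosMom a := by
  rw [cosMom_eq_intervalIntegral, cosMom_eq_intervalIntegral, integral_cos_pow]
  simp [sin_pi, sin_neg]

/-- Odd moments vanish: `J(2q+1) = 0`. [folklore] -/
theorem cosMom_odd (q : ℕ) : cosMom (2 * q + 1) = 0 := by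
  induction q with
  | zero => simpa using cosMom_one
  | succ q ih =>
    rw [show 2 * (q + 1) + 1 = (2 * q + 1) + 2 by ring, cosMom_add_two, ih, mul_zero]

/-- Even moments are nonnegative. [folklore] -/
theorem cosMom_even_nonneg (q : ℕ) : 0 ≤ cosMom (2 * q) :=
  integral_nonneg fun _ => Even.pow_nonneg (even_two_mul q) _

/-- Gaussian domination in one dimension: `J(2q) ≤ 2π · (2q-1)‼ · 2^{-q}`
(indeed `J(2q) = 2π (2q-1)‼/(2q)‼` and `(2q)‼ = 2^q q! ≥ 2^q`). [folklore] -/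
theorem cosMom_even_le (q : ℕ) :
    cosMom (2 * q) ≤ 2 * π * (((2 * q - 1)‼ : ℕ) * (1 / 2 : ℝ) ^ q) := by
  induction q with
  | zero => simp [cosMom_zero]
  | succ q ih =>
    have hdf : ((2 * q + 2 - 1)‼ : ℕ) = (2 * q + 1) * (2 * q - 1)‼ := by
      rw [show 2 * q + 2 - 1 = 2 * q + 1 by omega]
      exact Nat.doubleFactorial_add_one (2 * q)
    rw [show 2 * (q + 1) = 2 * q + 2 by ring, cosMom_add_two, hdf]
    have hq : (0 : ℝ) ≤ (2 * q + 1) / (2 * q + 2) := by positivity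
    have hX : (0 : ℝ) ≤ ((2 * q - 1)‼ : ℕ) := Nat.cast_nonneg _
    calc ((2 * q : ℕ) + 1) / ((2 * q : ℕ) + 2) * cosMom (2 * q)
        ≤ (2 * q + 1) / (2 * q + 2) * (2 * π * (((2 * q - 1)‼ : ℕ) * (1 / 2 : ℝ) ^ q)) := by
          push_cast
          exact mul_le_mul_of_nonneg_left ih hq
      _ ≤ 2 * π * ((((2 * q + 1) * (2 * q - 1)‼ : ℕ) : ℝ) * (1 / 2 : ℝ) ^ (q + 1)) := by
          push_cast
          rw [pow_succ]
          have h2 : (2 * (q : ℝ) + 1) / (2 * q + 2) ≤ (2 * q + 1) * (1 / 2) := by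
            rw [div_le_iff₀ (by positivity)]
            nlinarith
          have hπ : (0 : ℝ) ≤ 2 * π * (((2 * q - 1)‼ : ℕ) * (1 / 2 : ℝ) ^ q) := by positivity
          calc (2 * (q : ℝ) + 1) / (2 * q + 2) * (2 * π * (((2 * q - 1)‼ : ℕ) * (1 / 2 : ℝ) ^ q))
              ≤ (2 * q + 1) * (1 / 2) * (2 * π * (((2 * q - 1)‼ : ℕ) * (1 / 2 : ℝ) ^ q)) :=
                mul_le_mul_of_nonneg_right h2 hπ
            _ = 2 * π * ((2 * q + 1) * ((2 * q - 1)‼ : ℕ) * ((1 / 2 : ℝ) ^ q * (1 / 2))) := by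
                ring

/-! ### Part 2. Moments of `S_d(k) = Σ_j cos k_j` under the product measure -/

/-- `S_d(k) = Σ_j cos(k_j) = d · D̂(k)`. [folklore] -/
def cosCoordSum (d : ℕ) (k : Fin d → ℝ) : ℝ := ∑ j, Real.cos (k j)

/-- The un-normalised moments `M_d(m) = ∫_{[-π,π]^d} S_d(k)^m dk`. [folklore] -/
def sumMom (d m : ℕ) : ℝ := ∫ k, cosCoordSum d k ^ m ∂P d

/-- `S_d` is continuous. [folklore] -/
theorem continuous_cosCoordSum (d : ℕ) : Continuous (cosCoordSum d) :=
  continuous_finsetSum _ fun j _ => Real.continuous_cos.comp (continuous_apply j)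

/-- `|S_d(k)| ≤ d`. [folklore] -/
theorem abs_cosCoordSum_le (d : ℕ) (k : Fin d → ℝ) : |cosCoordSum d k| ≤ d := by
  unfold cosCoordSum
  calc |∑ j, Real.cos (k j)| ≤ ∑ j, |Real.cos (k j)| := abs_sum_le_sum_abs _ _
    _ ≤ ∑ _j : Fin d, (1 : ℝ) := sum_le_sum fun j _ => abs_cos_le_one _
    _ = d := by simp

/-- Even moments are nonnegative. [folklore] -/
theorem sumMom_even_nonneg (d q : ℕ) : 0 ≤ sumMom d (2 * q) :=
  integral_nonneg fun _ => Even.pow_nonneg (even_two_mul q) _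

/-- Integrability of the product integrands `cos(x)^a · S_d(y)^b` on `[-π,π] × [-π,π]^d`.
[folklore] -/
theorem integrable_cos_pow_mul_cosCoordSum_pow (d a b : ℕ) :
    Integrable (fun z : ℝ × (Fin d → ℝ) => Real.cos z.1 ^ a * cosCoordSum d z.2 ^ b)
      (μI.prod (P d)) := by
  have hcont : Continuous (fun z : ℝ × (Fin d → ℝ) => Real.cos z.1 ^ a * cosCoordSum d z.2 ^ b) :=
    ((Real.continuous_cos.comp continuous_fst).pow a).mul
      (((continuous_cosCoordSum d).comp continuous_snd).pow b)
  refine (integrable_const ((d : ℝ) ^ b)).mono' hcont.aestronglyMeasurable (ae_of_all _ ?_)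
  intro z
  rw [Real.norm_eq_abs, abs_mul, abs_pow, abs_pow]
  calc |Real.cos z.1| ^ a * |cosCoordSum d z.2| ^ b ≤ 1 ^ a * (d : ℝ) ^ b :=
        mul_le_mul (pow_le_pow_left₀ (abs_nonneg _) (abs_cos_le_one _) a)
          (pow_le_pow_left₀ (abs_nonneg _) (abs_cosCoordSum_le d z.2) b) (by positivity)
          (by positivity)
    _ = (d : ℝ) ^ b := by rw [one_pow, one_mul]

/-- In dimension `0`: `M_0(m) = 0^m` (the empty product measure has mass `1`). [folklore] -/
theorem sumMom_zero_dim (m : ℕ) : sumMom 0 m = (0 : ℝ) ^ m := by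
  have hmass : (P 0).real Set.univ = 1 := by
    rw [measureReal_def, show P 0 = Measure.pi (fun _ : Fin 0 => μI) from rfl, Measure.pi_univ,
      Finset.univ_eq_empty, Finset.prod_empty, ENNReal.toReal_one]
  have h0 : ∀ k : Fin 0 → ℝ, cosCoordSum 0 k = 0 := fun k => by simp [cosCoordSum]
  simp_rw [sumMom, h0]
  rw [integral_const, hmass, one_smul]

/-- **The recursion** (independence of the coordinates): deleting coordinate `0`,
`M_{d+1}(m) = Σ_{a ≤ m} C(m,a) J(a) M_d(m-a)`. [folklore] -/
theorem sumMom_succ (d m : ℕ) :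
    sumMom (d + 1) m =
      ∑ a ∈ range (m + 1), ((m.choose a : ℕ) : ℝ) * cosMom a * sumMom d (m - a) := by
  have hmp : MeasurePreserving (MeasurableEquiv.piFinSuccAbove (fun _ : Fin (d + 1) => ℝ) 0)
      (P (d + 1)) (μI.prod (P d)) :=
    measurePreserving_piFinSuccAbove (fun _ : Fin (d + 1) => μI) 0
  have h := hmp.integral_comp'
    (g := fun z : ℝ × (Fin d → ℝ) => (Real.cos z.1 + cosCoordSum d z.2) ^ m)
  have h1 : sumMom (d + 1) m = ∫ k, (fun z : ℝ × (Fin d → ℝ) => (Real.cos z.1 + cosCoordSum d z.2) ^ m)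
      ((MeasurableEquiv.piFinSuccAbove (fun _ : Fin (d + 1) => ℝ) 0) k) ∂P (d + 1) := by
    unfold sumMom
    congr 1
    ext k
    rw [cosCoordSum, Fin.sum_univ_succAbove _ (0 : Fin (d + 1))]
    rfl
  have hexp : ∀ z : ℝ × (Fin d → ℝ), (Real.cos z.1 + cosCoordSum d z.2) ^ m =
      ∑ a ∈ range (m + 1), ((m.choose a : ℕ) : ℝ) * (Real.cos z.1 ^ a * cosCoordSum d z.2 ^ (m - a)) := by
    intro z
    rw [add_pow]
    exact sum_congr rfl fun a _ => by ring
  rw [h1, h]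
  simp_rw [hexp]
  rw [integral_finsetSum _ fun a _ => (integrable_cos_pow_mul_cosCoordSum_pow d a (m - a)).const_mul _]
  refine sum_congr rfl fun a _ => ?_
  rw [integral_const_mul,
    show (∫ z : ℝ × (Fin d → ℝ), Real.cos z.1 ^ a * cosCoordSum d z.2 ^ (m - a) ∂μI.prod (P d)) =
      cosMom a * sumMom d (m - a) from
      integral_prod_mul (fun x => Real.cos x ^ a) (fun y => cosCoordSum d y ^ (m - a))]
  ring

/-! ### Part 3. The Gaussian moment identity and the domination bound -/

/-- `(2k-1)‼ · 2^k · k! = (2k)!`. [folklore] -/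
theorem oddDoubleFactorial_mul (k : ℕ) :
    (((2 * k - 1)‼ : ℕ) : ℝ) * (2 ^ k * k !) = (2 * k)! := by
  rcases k with _ | k
  · simp
  · have h1 : (2 * (k + 1))! = (2 * (k + 1))‼ * (2 * k + 1)‼ := by
      rw [show 2 * (k + 1) = (2 * k + 1) + 1 by ring]
      exact Nat.factorial_eq_mul_doubleFactorial (2 * k + 1)
    have h2 : (2 * (k + 1))‼ = 2 ^ (k + 1) * (k + 1)! := Nat.doubleFactorial_two_mul (k + 1)
    rw [show 2 * (k + 1) - 1 = 2 * k + 1 by omega, h1, h2]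
    push_cast
    ring

/-- The Gaussian moment identity `C(2n,2q) (2(n-q)-1)‼ (2q-1)‼ = (2n-1)‼ C(n,q)` (`q ≤ n`):
both sides equal `(2n)! / (2^n q! (n-q)!)`. [folklore] -/
theorem choose_mul_oddDoubleFactorial (n q : ℕ) (hq : q ≤ n) :
    (((2 * n).choose (2 * q) : ℕ) : ℝ) * ((2 * (n - q) - 1)‼ : ℕ) * ((2 * q - 1)‼ : ℕ) =
      ((2 * n - 1)‼ : ℕ) * (n.choose q : ℕ) := by
  have hA := oddDoubleFactorial_mul q
  have hB := oddDoubleFactorial_mul (n - q)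
  have hC := oddDoubleFactorial_mul n
  have hc1 : (((2 * n).choose (2 * q) : ℕ) : ℝ) * (2 * q)! * (2 * (n - q))! = (2 * n)! := by
    have := Nat.choose_mul_factorial_mul_factorial (show 2 * q ≤ 2 * n by omega)
    rw [show 2 * n - 2 * q = 2 * (n - q) by omega] at this
    exact_mod_cast this
  have hc2 : ((n.choose q : ℕ) : ℝ) * q ! * (n - q)! = n ! := by
    exact_mod_cast Nat.choose_mul_factorial_mul_factorial hq
  have hpos : (0 : ℝ) < 2 ^ n * q ! * (n - q)! := by positivity
  apply mul_right_cancel₀ hpos.ne'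
  have h2n : (2 : ℝ) ^ n = 2 ^ q * 2 ^ (n - q) := by rw [← pow_add, Nat.add_sub_cancel' hq]
  calc (((2 * n).choose (2 * q) : ℕ) : ℝ) * ((2 * (n - q) - 1)‼ : ℕ) * ((2 * q - 1)‼ : ℕ) *
        (2 ^ n * q ! * (n - q)!)
      = (((2 * n).choose (2 * q) : ℕ) : ℝ) * ((((2 * q - 1)‼ : ℕ) : ℝ) * (2 ^ q * q !)) *
          ((((2 * (n - q) - 1)‼ : ℕ) : ℝ) * (2 ^ (n - q) * (n - q)!)) := by
        rw [h2n]; ring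
    _ = (((2 * n).choose (2 * q) : ℕ) : ℝ) * (2 * q)! * (2 * (n - q))! := by rw [hA, hB]
    _ = (2 * n)! := hc1
    _ = ((2 * n - 1)‼ : ℕ) * (n.choose q : ℕ) * (2 ^ n * q ! * (n - q)!) := by
        rw [← hC, ← hc2]; ring

/-- A sum over `range (2n+1)` of a sequence vanishing at odd indices is the sum over the even
indices. [folklore] -/
theorem sum_range_two_mul_add_one_of_odd_eq_zero {f : ℕ → ℝ} (hf : ∀ q, f (2 * q + 1) = 0)
    (n : ℕ) : ∑ a ∈ range (2 * n + 1), f a = ∑ q ∈ range (n + 1), f (2 * q) := by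
  induction n with
  | zero => simp
  | succ n ih =>
    rw [show 2 * (n + 1) + 1 = (2 * n + 1) + 1 + 1 by ring, sum_range_succ, sum_range_succ, ih,
      hf n, add_zero, sum_range_succ (fun q => f (2 * q)) (n + 1),
      show 2 * n + 1 + 1 = 2 * (n + 1) by ring]

/-- **Gaussian domination of the even moments of `S_d`**:
`∫_{[-π,π]^d} S_d(k)^{2n} dk ≤ (2π)^d (2n-1)‼ (d/2)^n`, i.e. `E[S_d^{2n}] ≤ E[G^{2n}]` for
`G ~ N(0, d/2)` (induction on `d` via `sumMom_succ`, `cosMom_even_le`, `cosMom_odd` and the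
Gaussian moment identity). [folklore] -/
theorem sumMom_even_le (d n : ℕ) :
    sumMom d (2 * n) ≤ (2 * π) ^ d * ((((2 * n - 1)‼ : ℕ) : ℝ) * ((d : ℝ) / 2) ^ n) := by
  induction d generalizing n with
  | zero =>
    rw [sumMom_zero_dim]
    rcases n with _ | n
    · simp
    · simp
  | succ d ih =>
    rw [sumMom_succ, sum_range_two_mul_add_one_of_odd_eq_zero
      (f := fun a => (((2 * n).choose a : ℕ) : ℝ) * cosMom a * sumMom d (2 * n - a))
      (fun q => by simp only [cosMom_odd, mul_zero, zero_mul]) n]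
    calc ∑ q ∈ range (n + 1), (((2 * n).choose (2 * q) : ℕ) : ℝ) * cosMom (2 * q) *
          sumMom d (2 * n - 2 * q)
        ≤ ∑ q ∈ range (n + 1), (((2 * n).choose (2 * q) : ℕ) : ℝ) *
            (2 * π * (((2 * q - 1)‼ : ℕ) * (1 / 2 : ℝ) ^ q)) *
            ((2 * π) ^ d * ((((2 * (n - q) - 1)‼ : ℕ) : ℝ) * ((d : ℝ) / 2) ^ (n - q))) := by
          refine sum_le_sum fun q hq => ?_
          have hqn : q ≤ n := Nat.lt_succ_iff.mp (mem_range.mp hq)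
          show (((2 * n).choose (2 * q) : ℕ) : ℝ) * cosMom (2 * q) * sumMom d (2 * n - 2 * q) ≤ _
          rw [show 2 * n - 2 * q = 2 * (n - q) by omega]
          have hπq : (0 : ℝ) ≤ 2 * π * (((2 * q - 1)‼ : ℕ) * (1 / 2 : ℝ) ^ q) := by positivity
          have h12 := mul_le_mul (cosMom_even_le q) (ih (n - q)) (sumMom_even_nonneg d (n - q)) hπq
          have hc : (0 : ℝ) ≤ (((2 * n).choose (2 * q) : ℕ) : ℝ) := Nat.cast_nonneg _
          calc (((2 * n).choose (2 * q) : ℕ) : ℝ) * cosMom (2 * q) * sumMom d (2 * (n - q))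
              = (((2 * n).choose (2 * q) : ℕ) : ℝ) * (cosMom (2 * q) * sumMom d (2 * (n - q))) :=
                by ring
            _ ≤ (((2 * n).choose (2 * q) : ℕ) : ℝ) * ((2 * π * (((2 * q - 1)‼ : ℕ) * (1 / 2 : ℝ) ^ q)) *
                ((2 * π) ^ d * ((((2 * (n - q) - 1)‼ : ℕ) : ℝ) * ((d : ℝ) / 2) ^ (n - q)))) :=
                mul_le_mul_of_nonneg_left h12 hc
            _ = _ := by ring
      _ = (2 * π) ^ (d + 1) * (((2 * n - 1)‼ : ℕ) : ℝ) *
            ∑ q ∈ range (n + 1), (1 / 2 : ℝ) ^ q * ((d : ℝ) / 2) ^ (n - q) * (n.choose q : ℕ) := by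
          rw [mul_sum]
          refine sum_congr rfl fun q hq => ?_
          have hqn : q ≤ n := Nat.lt_succ_iff.mp (mem_range.mp hq)
          have hid := choose_mul_oddDoubleFactorial n q hqn
          calc (((2 * n).choose (2 * q) : ℕ) : ℝ) * (2 * π * (((2 * q - 1)‼ : ℕ) * (1 / 2 : ℝ) ^ q)) *
                ((2 * π) ^ d * ((((2 * (n - q) - 1)‼ : ℕ) : ℝ) * ((d : ℝ) / 2) ^ (n - q)))
              = (2 * π) ^ (d + 1) * ((((2 * n).choose (2 * q) : ℕ) : ℝ) *
                  ((2 * (n - q) - 1)‼ : ℕ) * ((2 * q - 1)‼ : ℕ)) *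
                  ((1 / 2 : ℝ) ^ q * ((d : ℝ) / 2) ^ (n - q)) := by rw [pow_succ]; ring
            _ = (2 * π) ^ (d + 1) * (((2 * n - 1)‼ : ℕ) : ℝ) *
                  ((1 / 2 : ℝ) ^ q * ((d : ℝ) / 2) ^ (n - q) * (n.choose q : ℕ)) := by
                rw [hid]; ring
      _ = (2 * π) ^ (d + 1) * ((((2 * n - 1)‼ : ℕ) : ℝ) * (((d + 1 : ℕ) : ℝ) / 2) ^ n) := by
          rw [← add_pow (1 / 2 : ℝ) ((d : ℝ) / 2) n]
          push_cast
          ring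

end GaussDom

open GaussDom

/-- **Gaussian domination of the SRW return probabilities** (lemma "E1" of the large-`d`
certificate of the NoBLE inputs): for every `d ≥ 1` and `n ≥ 0`,
`p_{2n}(0; d) ≤ (2n-1)‼ / (2d)^n`.
Proof: `p_{2n}(0;d) = ∫ D̂^{2n} dk/(2π)^d = M_d(2n) / (d^{2n} (2π)^d)` and `sumMom_even_le`.
Together with `srwI_taylor`, `abs_srwI_le_srwI_zero_of_even`, `srwI_zero_dim_anti` and Hölder's
inequality on the torus this bounds every Taylor remainder `I_{j,M}(0;d)` by an explicit constant
times `(2d)^{-M/2}` (resp. `(2d)^{-a}`, `a ≥ M/2 - 1`), uniformly in `d`. [folklore] -/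
theorem srwLaw_two_mul_zero_le (hd : 1 ≤ d) (n : ℕ) :
    srwLaw d (2 * n) 0 ≤ (((2 * n - 1)‼ : ℕ) : ℝ) / (2 * (d : ℝ)) ^ n := by
  have hd0 : (d : ℝ) ≠ 0 := by exact_mod_cast (by omega : d ≠ 0)
  have hphi : ∀ k : Fin d → ℝ, phi 0 (2 * n) (Dhat d k) =
      (1 / (d : ℝ) ^ (2 * n)) * cosCoordSum d k ^ (2 * n) := by
    intro k
    rw [phi, pow_zero, mul_one, Dhat_def, div_pow, cosCoordSum]
    ring
  have h1 : srwLaw d (2 * n) 0 = sumMom d (2 * n) / ((d : ℝ) ^ (2 * n) * (2 * π) ^ d) := by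
    rw [← srwI_zero_eq_srwLaw, srwI_zero_eq_integral_phi]
    simp_rw [hphi]
    rw [integral_const_mul, sumMom]
    field_simp
  rw [h1]
  calc sumMom d (2 * n) / ((d : ℝ) ^ (2 * n) * (2 * π) ^ d)
      ≤ (2 * π) ^ d * ((((2 * n - 1)‼ : ℕ) : ℝ) * ((d : ℝ) / 2) ^ n) /
          ((d : ℝ) ^ (2 * n) * (2 * π) ^ d) :=
        div_le_div_of_nonneg_right (sumMom_even_le d n) (by positivity)
    _ = (((2 * n - 1)‼ : ℕ) : ℝ) / (2 * (d : ℝ)) ^ n := by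
        rw [pow_mul, mul_pow, div_pow]
        field_simp
        ring

/-- The same bound for every EVEN `m`: `p_m(0;d) ≤ (m-1)‼ / (2d)^{m/2}`. [folklore] -/
theorem srwLaw_even_zero_le (hd : 1 ≤ d) {m : ℕ} (hm : Even m) :
    srwLaw d m 0 ≤ (((m - 1)‼ : ℕ) : ℝ) / (2 * (d : ℝ)) ^ (m / 2) := by
  obtain ⟨n, rfl⟩ := hm
  rw [← two_mul, show 2 * n / 2 = n by omega]
  exact srwLaw_two_mul_zero_le hd n

end Literature.Probability.FitznerVanDerHofstad2017

end
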